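import Summits.Ventures.YMGap.RobustBall.LocalSourceScreeningS
import HarnessLib

/-!
# Venture YMGap, track ROBUST-BALL (Y2) — TIER 2 STATE STABILITY: the unique state is LIPSCHITZ in the action, in the
# oscillation-load seminorm, uniformly on the weighted infinite-range ball

HONEST FRAMING. WHAT THIS IS: a venture file (cell `pub-ymgap`, track Y2 ROBUST-BALL, seat rb-p1, theorems only): the tier-2 twin of
ds-1's `StateStability.lean` (there: finite-range members `perturbedYM`, the state is Lipschitz on the tier-1 ball in the oscillation load)
and the GLOBAL companion of `LocalSourceScreeningS.lean` (there: a source supported on a FINITE link set `S`, screened at the weight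
rate).  HERE the modification `V` of the action may have INFINITELY many terms through every link — any continuous link-summable
potential, of ANY strength and ANY range, inside the ball or not — and is measured only by its one-link OSCILLATION LOAD
`bV(x) ≥ Σ'_{X ∋ x} osc_X(x) ≤ η`:
* ★ `abs_integral_sub_integral_le_of_perturbation_S` — member `W` (continuous, link-summable, tier-2 loads `a`, `Λ_t` at weight
  `t ≥ 0`) inside the one-link pair door `ρ := 6(d−1)|β| e^{a} e^{t} √(cv) + e^{a/2} √c Λ_t < 1`; then EVERY DLR state `μ` of `W` and
  EVERY DLR state `ν` of `W + V` satisfy, for every bounded local `f` on `Δ` with Frobenius-Lipschitz vector `δ`,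
  `|∫ f dμ − ∫ f dν| ≤ (√N/2 · min(η, 4))/(1 − ρ) · Σ_{y ∈ Δ} δ_y` — the constant super-solution of Föllmer's comparison with defects
  (Literature `abs_integral_sub_integral_le_of_gibbs_pair_tsum`, summable rows) and the tier-2 one-link source defect
  (`oneLink_source_defect_S`: Grüss `√N η/2`, capped by the diameter `2√N`);
* `su2_stateStabilityS_dim4` — `SU(2)`, `ℤ⁴`, hypothesis-free: `6|β_W| e^{a} e^{t} + e^{a/2} √(2/3) Λ < 1` ⇒ on `MemBallZdS a Λ t`:
  `|∫ F dμ − ∫ F dν| ≤ (√2/2) · min(η, 4)/(1 − ρ) · #Λ_F · K_F` for every Lipschitz cylinder `F`;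
* `su2_wilson_stateStabilityS` — the Wilson point `0 ≤ β_W < 1/6` (`a = Λ = t = 0`, `ρ = 6β_W`): EVERY DLR state of EVERY continuous
  link-summable perturbation with oscillation load `≤ η` — finite range or not, small or not — lies within
  `(√2/2)·min(η,4)/(1 − 6β_W) · #Λ_F · K_F` of the Wilson state on every Lipschitz cylinder: THE STRONG-COUPLING STATE IS LIPSCHITZ-ROBUST
  AGAINST SUMMABLE INFINITE-RANGE MODIFICATIONS OF THE ACTION.
WHAT THIS IS NOT: one-sided (only the member's side contracts; nothing is claimed about uniqueness for `W + V` unless it lies in a ball);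
lattice strong coupling only; nothing about the continuum limit or a Clay-sense mass gap.
-/

noncomputable section

open MeasureTheory Function Finset ProbabilityTheory Real
open scoped NNReal
open Literature.Probability.LatticeModels
open Literature.Probability.LatticeModels.DobrushinMetric
open Literature.MathematicalPhysics.QuantumLattice
open Literature.MathematicalPhysics.QuantumFieldTheory hiding ZdEdge
open Summit.QuantumFields.BalabanUV.InfraRed.StrongCouplingPoincareDoorSUN (oneLinkPoincareSUN_two_sharp)

namespace Summit.Ventures.YMGap.RobustBall

variable {d N : ℕ}

/-! ### The constant super-solution -/

/-- With rows `Σ' C(x,y) ≤ ρ < 1` and a defect `b ≤ B'` everywhere, the CONSTANT `B'/(1 − ρ)` is a super-solution: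
`b x + Σ' C(x,y) · B'/(1−ρ) ≤ B'/(1−ρ)`. -/
theorem superSolution_const {V : Type*} {C : V → V → ℝ} {ρ B' : ℝ} (hρ1 : ρ < 1) (hB' : 0 ≤ B')
    (hrow : ∀ x, ∑' y, C x y ≤ ρ) {b : V → ℝ} (hbB : ∀ x, b x ≤ B') (x : V) :
    b x + ∑' y, C x y * (B' / (1 - ρ)) ≤ B' / (1 - ρ) := by
  have h1ρ : 0 < 1 - ρ := sub_pos.2 hρ1
  have hK : 0 ≤ B' / (1 - ρ) := div_nonneg hB' h1ρ.le
  have hsum : ∑' y, C x y * (B' / (1 - ρ)) ≤ ρ * (B' / (1 - ρ)) := by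
    rw [tsum_mul_right]
    exact mul_le_mul_of_nonneg_right (hrow x) hK
  have hfix : B' + ρ * (B' / (1 - ρ)) = B' / (1 - ρ) := by
    field_simp
    ring
  linarith [hbB x]

section SUN

variable {W V : Potential (ZdEdge d) (Matrix.specialUnitaryGroup (Fin N) ℂ)} {BW BV : Finset (ZdEdge d) → ℝ}

/-- ★ **TIER 2 STATE STABILITY: the state is Lipschitz in the action, in the oscillation-load seminorm, uniformly on the weighted
ball.**  Member `W` (continuous, link-summable, tier-2 loads: oscillation `≤ a`, weighted diagonal-free cross load `≤ Λ_t` at weight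
`t ≥ 0`) inside the one-link pair door `ρ := 6(d−1)|β| e^{a} e^{t} √(c v) + e^{a/2} √c Λ_t < 1`; modification `V` (continuous,
link-summable, ANY strength, ANY range) whose one-link oscillation loads are `≤ η` EVERYWHERE.  Then every DLR `μ` of `W` and EVERY DLR `ν`
of `W + V` satisfy, for every bounded local `f` on `Δ` with Frobenius-Lipschitz vector `δ`:
`|∫ f dμ − ∫ f dν| ≤ (√N/2 · min(η, 4))/(1 − ρ) · Σ_{y ∈ Δ} δ_y`. -/
theorem abs_integral_sub_integral_le_of_perturbation_S (hd : 1 ≤ d) (hN : 1 ≤ N) {β b c v a Λt t : ℝ}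
    (hc : 0 ≤ c) (hv : 0 ≤ v) (hb : |β| * (2 * ((d : ℝ) - 1)) ≤ b)
    (hP : ∀ B : Matrix (Fin N) (Fin N) ℂ, matrixOpNorm B ≤ b →
      ∀ (ψ : Matrix.specialUnitaryGroup (Fin N) ℂ → ℝ) (M : ℝ), 0 ≤ M →
        (∀ x y, |ψ x - ψ y| ≤ M * suFrobDist x y) →
        Var[ψ; (haarProbability (Matrix.specialUnitaryGroup (Fin N) ℂ)).tilted
          fun g => (N : ℝ) * ((g : Matrix (Fin N) (Fin N) ℂ) * B).trace.re] ≤ c * M ^ 2)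
    (hVB : ∀ B : Matrix (Fin N) (Fin N) ℂ, matrixOpNorm B ≤ b → ∀ Δ : Matrix (Fin N) (Fin N) ℂ,
      Var[fun g : Matrix.specialUnitaryGroup (Fin N) ℂ =>
          (N : ℝ) * ((g : Matrix (Fin N) (Fin N) ℂ) * Δ).trace.re;
        (haarProbability (Matrix.specialUnitaryGroup (Fin N) ℂ)).tilted
          fun g => (N : ℝ) * ((g : Matrix (Fin N) (Fin N) ℂ) * B).trace.re] ≤ v * frobNorm Δ ^ 2)
    (h : IsLinkSummable W BW) (hWc : ∀ X, Continuous (W X))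
    (hWdep : ∀ X, DependsOn (W X) (↑X : Set (ZdEdge d)))
    {osc : Finset (ZdEdge d) → ZdEdge d → ℝ} (hosc : ∀ X, Dobrushin.IsOscBound (W X) (osc X))
    (hoscs : ∀ e, Summable fun X : Finset (ZdEdge d) => (if e ∈ X then osc X e else 0))
    (hosca : ∀ e, ∑' X : Finset (ZdEdge d), (if e ∈ X then osc X e else 0) ≤ a)
    {lip : Finset (ZdEdge d) → ZdEdge d → ℝ} (hlip : ∀ X, IsLipBound suFrobDist (W X) (lip X))
    {ℓ : ZdEdge d → ZdEdge d → ℝ}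
    (hlips : ∀ e y, Summable fun X : Finset (ZdEdge d) => (if e ∈ X ∧ y ∈ X then lip X y else 0))
    (hℓ : ∀ e y, y ≠ e → ∑' X : Finset (ZdEdge d), (if e ∈ X ∧ y ∈ X then lip X y else 0) ≤ ℓ e y)
    (ht : 0 ≤ t) (hℓs : ∀ e, Summable fun y => (if y = e then 0 else ℓ e y) * exp (t * ‖e.1 - y.1‖))
    (hℓt : ∀ e, ∑' y, (if y = e then 0 else ℓ e y) * exp (t * ‖e.1 - y.1‖) ≤ Λt)
    (hρ : 6 * ((d : ℝ) - 1) * |β| * (exp a * exp t * Real.sqrt (c * v)) + exp (a / 2) * Real.sqrt c * Λt < 1)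
    (hV : IsLinkSummable V BV) (hVc : ∀ X, Continuous (V X)) (hVdep : ∀ X, DependsOn (V X) (↑X : Set (ZdEdge d)))
    {oscV : Finset (ZdEdge d) → ZdEdge d → ℝ} (hoscV : ∀ X, Dobrushin.IsOscBound (V X) (oscV X))
    (hoscVs : ∀ e, Summable fun X : Finset (ZdEdge d) => (if e ∈ X then oscV X e else 0))
    {bV : ZdEdge d → ℝ} (hbV : ∀ e, ∑' X : Finset (ZdEdge d), (if e ∈ X then oscV X e else 0) ≤ bV e)
    {η : ℝ} (hη : ∀ e, bV e ≤ η)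
    {μ ν : Measure (LGConfig d (Matrix.specialUnitaryGroup (Fin N) ℂ))}
    (hμ : μ ∈ perturbedGibbsMeasuresS (d := d) (fundamentalRep (Fin N)) (N * β) W)
    (hν : ν ∈ perturbedGibbsMeasuresS (d := d) (fundamentalRep (Fin N)) (N * β) (W + V))
    {f : LGConfig d (Matrix.specialUnitaryGroup (Fin N) ℂ) → ℝ} (hfm : Measurable f)
    {Δ : Finset (ZdEdge d)} (hfdep : DependsOn f (↑Δ : Set (ZdEdge d))) {M : ℝ} (hM : ∀ σ, |f σ| ≤ M)
    {δ : ZdEdge d → ℝ} (hδ : IsLipBound suFrobDist f δ) :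
    |(∫ σ, f σ ∂μ) - ∫ σ, f σ ∂ν| ≤
      Real.sqrt N / 2 * min η 4 / (1 - (6 * ((d : ℝ) - 1) * |β| * (exp a * exp t * Real.sqrt (c * v)) +
        exp (a / 2) * Real.sqrt c * Λt)) * ∑ y ∈ Δ, δ y := by
  classical
  haveI : SecondCountableTopology (Matrix (Fin N) (Fin N) ℂ) :=
    inferInstanceAs (SecondCountableTopology (Fin N → Fin N → ℂ))
  haveI : SecondCountableTopology (Matrix.specialUnitaryGroup (Fin N) ℂ) :=
    Topology.IsEmbedding.subtypeVal.secondCountableTopology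
  set ρ : ℝ := 6 * ((d : ℝ) - 1) * |β| * (exp a * exp t * Real.sqrt (c * v)) + exp (a / 2) * Real.sqrt c * Λt with hρdef
  have hWV : IsLinkSummable (W + V) (BW + BV) := h.add hV
  have hWVc : ∀ X, Continuous ((W + V) X) := fun X => (hWc X).add (hVc X)
  have hWVdep : ∀ X, DependsOn ((W + V) X) (↑X : Set (ZdEdge d)) := fun X σ τ hστ => by
    simp only [Pi.add_apply, hWdep X hστ, hVdep X hστ]
  have hγ : IsSpecification (perturbedYMS (d := d) (fundamentalRep (Fin N)) (N * β) W) :=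
    isSpecification_perturbedYMS _ (continuous_fundamentalRep (Fin N)) _ h hWc hWdep
  have hγ' : IsSpecification (perturbedYMS (d := d) (fundamentalRep (Fin N)) (N * β) (W + V)) :=
    isSpecification_perturbedYMS _ (continuous_fundamentalRep (Fin N)) _ hWV hWVc hWVdep
  have hμ' : IsGibbsMeasure (perturbedYMS (d := d) (fundamentalRep (Fin N)) (N * β) W) μ := hμ
  have hν' : IsGibbsMeasure (perturbedYMS (d := d) (fundamentalRep (Fin N)) (N * β) (W + V)) ν := hν
  have hℓ0 : ∀ x y, y ≠ x → 0 ≤ ℓ x y := fun x y hyx => by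
    refine le_trans (tsum_nonneg fun X => ?_) (hℓ x y hyx)
    split_ifs
    · exact (hlip X).nonneg y
    · exact le_rfl
  have hrow := fun x => summable_coeffS_row₀ (β := β) (c := c) (v := v) (a := a) hd hℓ0 ht hℓs hℓt x
  have hℓs' : ∀ e, Summable fun y => (if y = e then 0 else ℓ e y) := fun e =>
    Summable.of_nonneg_of_le (fun y => by split_ifs with hye; exacts [le_rfl, hℓ0 e y hye])
      (fun y => le_mul_of_one_le_right (by split_ifs with hye; exacts [le_rfl, hℓ0 e y hye])
        (one_le_exp (by positivity))) (hℓs e)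
  set C : ZdEdge d → ZdEdge d → ℝ := fun x y => if y = x then 0 else
      (exp a * Real.sqrt (c * v) * |β| * linkInfluence x y + exp (a / 2) * Real.sqrt c * ℓ x y) with hCdef
  have hC0 : ∀ x y, 0 ≤ C x y := fun x y => by
    simp only [hCdef]
    split_ifs with hyx
    · exact le_rfl
    · exact add_nonneg (by positivity) (mul_nonneg (by positivity) (hℓ0 x y hyx))
  have hd0 : 0 < d := hd
  have hρ0 : 0 ≤ ρ := (tsum_nonneg (hC0 (0, ⟨0, hd0⟩))).trans (hrow (0, ⟨0, hd0⟩)).2.2.1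
  have h1ρ : 0 < 1 - ρ := sub_pos.2 hρ
  have hbV0 : ∀ e, 0 ≤ bV e := fun e =>
    le_trans (tsum_nonneg fun X => by split_ifs; exacts [(hoscV X).nonneg e, le_rfl]) (hbV e)
  have hηmin : 0 ≤ min η 4 := le_min ((hbV0 (0, ⟨0, hd0⟩)).trans (hη _)) (by norm_num)
  set B' : ℝ := Real.sqrt N / 2 * min η 4 with hB'def
  have hB'0 : 0 ≤ B' := by positivity
  set bdef : ZdEdge d → ℝ := fun x => Real.sqrt N / 2 * min (bV x) 4 with hbdef_def
  have hb0 : ∀ x, 0 ≤ bdef x := fun x => mul_nonneg (by positivity) (le_min (hbV0 x) (by norm_num))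
  have hbB : ∀ x, bdef x ≤ B' := fun x => mul_le_mul_of_nonneg_left (min_le_min_right 4 (hη x)) (by positivity)
  have hsuper : ∀ x, bdef x + ∑' y, C x y * (B' / (1 - ρ)) ≤ B' / (1 - ρ) :=
    superSolution_const hρ hB'0 (fun x => (hrow x).2.2.1) hbB
  have hdd0 : ∀ _y : ZdEdge d, 0 ≤ B' / (1 - ρ) := fun _ => div_nonneg hB'0 h1ρ.le
  have hddD : ∀ _y : ZdEdge d, B' / (1 - ρ) ≤ B' / (1 - ρ) := fun _ => le_rfl
  have hker : ∀ (x : ZdEdge d) (η' : LGConfig d (Matrix.specialUnitaryGroup (Fin N) ℂ))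
      (φ : Matrix.specialUnitaryGroup (Fin N) ℂ → ℝ) (L : ℝ), Measurable φ → (∃ M, ∀ s, |φ s| ≤ M) →
      0 ≤ L → (∀ a a', |φ a - φ a'| ≤ L * suFrobDist a a') →
      |(∫ s, φ s ∂(siteLaw (perturbedYMS (fundamentalRep (Fin N)) (N * β) W) x η')) -
          ∫ s, φ s ∂(siteLaw (perturbedYMS (fundamentalRep (Fin N)) (N * β) (W + V)) x η')| ≤ bdef x * L :=
    fun x η' φ L hφm hφb hL hφL => by
      simpa only [hbdef_def] using oneLink_source_defect_S β h hWc hWdep hV hVc hVdep hoscV x (hoscVs x) (hbV x) η' φ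
        L hφm hφb hL hφL
  have key := abs_integral_sub_integral_le_of_gibbs_pair_tsum hγ hγ' (by positivity : (0 : ℝ) ≤ 2 * Real.sqrt N)
    (fun _ _ => suFrobDist_nonneg _ _) suFrobDist_le suFrobDist_self hC0 (fun x => (hrow x).1)
    (fun x ω η' φ L hφm hφb hL hφL => abs_integral_siteLaw_perturbedYMS_sub_le_tsum₀ hd hN hc hv hb hP hVB
      h hWc hWdep hosc hoscs hosca hlip hlips hℓ hℓs' x ω η' φ L hφm hφb hL hφL)
    hρ0 hρ (fun x => (hrow x).2.2.1) hμ' hν' hb0 hker hdd0 hddD hsuper hfm hfdep hM hδ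
  refine key.trans (le_of_eq ?_)
  rw [Finset.mul_sum]

end SUN

/-! ### `SU(2)`, `ℤ⁴`, uniformly on the weighted ball, hypothesis-free -/

/-- **`SU(2)`, `ℤ⁴` — TIER 2 STATE STABILITY, uniformly on `MemBallZdS a Λ t`.**  `0 ≤ t`, `6|β_W| e^{a} e^{t} + e^{a/2} √(2/3) Λ < 1` ⇒ for
every member `W` of the weighted infinite-range ball (bare coupling `β_W/2`), every continuous link-summable modification `V` (ANY strength,
ANY range) with one-link oscillation loads `≤ η`, every DLR `μ` of `W`, EVERY DLR `ν` of `W + V`, every Lipschitz cylinder `F` (`Λ_F`, `K_F`):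
`|∫ F dμ − ∫ F dν| ≤ (√2/2) · min(η, 4)/(1 − ρ) · #Λ_F · K_F`, `ρ = 6|β_W| e^{a} e^{t} + e^{a/2} √(2/3) Λ`. -/
theorem su2_stateStabilityS_dim4 {βW a Λ t : ℝ} (ht : 0 ≤ t)
    (hρ : 6 * |βW| * (exp a * exp t) + exp (a / 2) * Real.sqrt (2 / 3) * Λ < 1)
    {W V : Potential (ZdEdge 4) (Matrix.specialUnitaryGroup (Fin 2) ℂ)} (hmem : MemBallZdS a Λ t W)
    {BV : Finset (ZdEdge 4) → ℝ} (hV : IsLinkSummable V BV) (hVc : ∀ X, Continuous (V X))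
    (hVdep : ∀ X, DependsOn (V X) (↑X : Set (ZdEdge 4)))
    {oscV : Finset (ZdEdge 4) → ZdEdge 4 → ℝ} (hoscV : ∀ X, Dobrushin.IsOscBound (V X) (oscV X))
    (hoscVs : ∀ e, Summable fun X : Finset (ZdEdge 4) => (if e ∈ X then oscV X e else 0))
    {bV : ZdEdge 4 → ℝ} (hbV : ∀ e, ∑' X : Finset (ZdEdge 4), (if e ∈ X then oscV X e else 0) ≤ bV e)
    {η : ℝ} (hη : ∀ e, bV e ≤ η)
    {μ ν : Measure (LGConfig 4 (Matrix.specialUnitaryGroup (Fin 2) ℂ))}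
    (hμ : μ ∈ perturbedGibbsMeasuresS (d := 4) (fundamentalRep (Fin 2)) (2 * (βW / 4)) W)
    (hν : ν ∈ perturbedGibbsMeasuresS (d := 4) (fundamentalRep (Fin 2)) (2 * (βW / 4)) (W + V))
    {F : LGConfig 4 (Matrix.specialUnitaryGroup (Fin 2) ℂ) → ℝ} {ΛF : Finset (ZdEdge 4)} {KF : ℝ≥0}
    (hF : IsLipschitzCylinder (fundamentalRep (Fin 2)) F ΛF KF) :
    |(∫ σ, F σ ∂μ) - ∫ σ, F σ ∂ν| ≤
      Real.sqrt 2 / 2 * min η 4 / (1 - (6 * |βW| * (exp a * exp t) + exp (a / 2) * Real.sqrt (2 / 3) * Λ)) * (ΛF.card * KF) := by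
  classical
  haveI : SecondCountableTopology (Matrix (Fin 2) (Fin 2) ℂ) :=
    inferInstanceAs (SecondCountableTopology (Fin 2 → Fin 2 → ℂ))
  haveI : SecondCountableTopology (Matrix.specialUnitaryGroup (Fin 2) ℂ) :=
    Topology.IsEmbedding.subtypeVal.secondCountableTopology
  obtain ⟨BW, h⟩ := hmem.summable
  obtain ⟨osc, lip, ℓ, hosc, hlip, hoscs, hosca, hlips, hℓ, hℓs, hℓt⟩ := hmem.loads
  have hc : (0 : ℝ) ≤ 2 / 3 := by norm_num
  have hP : ∀ B : Matrix (Fin 2) (Fin 2) ℂ, matrixOpNorm B ≤ |βW / 4| * (2 * (((4 : ℕ) : ℝ) - 1)) →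
      ∀ (ψ : Matrix.specialUnitaryGroup (Fin 2) ℂ → ℝ) (M : ℝ), 0 ≤ M →
        (∀ x y, |ψ x - ψ y| ≤ M * suFrobDist x y) →
        Var[ψ; (haarProbability (Matrix.specialUnitaryGroup (Fin 2) ℂ)).tilted
          fun g => ((2 : ℕ) : ℝ) * ((g : Matrix (Fin 2) (Fin 2) ℂ) * B).trace.re] ≤ 2 / 3 * M ^ 2 :=
    fun B hB ψ M hM hψ => oneLinkPoincareSUN_two_sharp _ B hB ψ M hM hψ
  have hVB := linVariance_of_poincare (N := 2) hP
  have hv : (0 : ℝ) ≤ 2 / 3 * ((2 : ℕ) : ℝ) ^ 2 := by norm_num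
  have hsq : Real.sqrt (2 / 3 * (2 / 3 * ((2 : ℕ) : ℝ) ^ 2)) = 4 / 3 := by
    rw [show (2 / 3 * (2 / 3 * ((2 : ℕ) : ℝ) ^ 2) : ℝ) = (4 / 3) ^ 2 by norm_num, Real.sqrt_sq (by norm_num)]
  have hρeq : 6 * (((4 : ℕ) : ℝ) - 1) * |βW / 4| * (exp a * exp t * Real.sqrt (2 / 3 * (2 / 3 * ((2 : ℕ) : ℝ) ^ 2))) +
      exp (a / 2) * Real.sqrt (2 / 3) * Λ = 6 * |βW| * (exp a * exp t) + exp (a / 2) * Real.sqrt (2 / 3) * Λ := by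
    rw [hsq, abs_div, abs_of_pos (by norm_num : (0 : ℝ) < 4)]
    norm_num; ring
  have hρ' : 6 * (((4 : ℕ) : ℝ) - 1) * |βW / 4| * (exp a * exp t * Real.sqrt (2 / 3 * (2 / 3 * ((2 : ℕ) : ℝ) ^ 2))) +
      exp (a / 2) * Real.sqrt (2 / 3) * Λ < 1 := by rw [hρeq]; exact hρ
  have hμ' : μ ∈ perturbedGibbsMeasuresS (d := 4) (fundamentalRep (Fin 2)) ((2 : ℕ) * (βW / 4)) W := by
    simpa using hμ
  have hν' : ν ∈ perturbedGibbsMeasuresS (d := 4) (fundamentalRep (Fin 2)) ((2 : ℕ) * (βW / 4)) (W + V) := by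
    simpa using hν
  have hA : ∀ a b : Matrix.specialUnitaryGroup (Fin 2) ℂ,
      dist (suEntries a) (suEntries b) ≤ 1 * suFrobDist a b :=
    fun a b => by rw [one_mul]; exact dist_suEntries_le_suFrobDist a b
  have key := abs_integral_sub_integral_le_of_perturbation_S (N := 2) (d := 4) (by norm_num) (by norm_num) hc hv le_rfl hP hVB
    h hmem.continuous hmem.dependsOn hosc hoscs hosca hlip hlips hℓ ht hℓs hℓt hρ' hV hVc hVdep hoscV hoscVs hbV hη
    hμ' hν' hF.measurable hF.dependsOn hF.abs_le (hF.isLipBound zero_le_one hA)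
  rw [hρeq] at key
  refine key.trans ?_
  set ρ : ℝ := 6 * |βW| * (exp a * exp t) + exp (a / 2) * Real.sqrt (2 / 3) * Λ with hρdef
  have h1ρ : 0 < 1 - ρ := sub_pos.2 hρ
  have hbV0 : ∀ e, 0 ≤ bV e := fun e =>
    le_trans (tsum_nonneg fun X => by split_ifs; exacts [(hoscV X).nonneg e, le_rfl]) (hbV e)
  have hηmin : 0 ≤ min η 4 := le_min ((hbV0 ((0 : Fin 4 → ℤ), (0 : Fin 4))).trans (hη _)) (by norm_num)
  have hK0 : 0 ≤ Real.sqrt ((2 : ℕ) : ℝ) / 2 * min η 4 / (1 - ρ) := by positivity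
  have hmono : ∑ y ∈ ΛF, (if y ∈ ΛF then (1 : ℝ) * (KF : ℝ) else 0) ≤ ΛF.card * KF := by
    calc ∑ y ∈ ΛF, (if y ∈ ΛF then (1 : ℝ) * (KF : ℝ) else 0) = ∑ _y ∈ ΛF, (KF : ℝ) :=
          Finset.sum_congr rfl fun y hy => by rw [if_pos hy, one_mul]
      _ = ΛF.card * KF := by rw [Finset.sum_const, nsmul_eq_mul]
      _ ≤ ΛF.card * KF := le_rfl
  have h2 : Real.sqrt ((2 : ℕ) : ℝ) = Real.sqrt 2 := by norm_num
  calc Real.sqrt ((2 : ℕ) : ℝ) / 2 * min η 4 / (1 - ρ) * ∑ y ∈ ΛF, (if y ∈ ΛF then (1 : ℝ) * (KF : ℝ) else 0)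
      ≤ Real.sqrt ((2 : ℕ) : ℝ) / 2 * min η 4 / (1 - ρ) * (ΛF.card * KF) := mul_le_mul_of_nonneg_left hmono hK0
    _ = Real.sqrt 2 / 2 * min η 4 / (1 - ρ) * (ΛF.card * KF) := by rw [h2]

/-- **THE `SU(2)` WILSON POINT ON `ℤ⁴`, `0 ≤ β_W < 1/6`: THE STRONG-COUPLING STATE IS LIPSCHITZ-ROBUST AGAINST SUMMABLE INFINITE-RANGE
MODIFICATIONS OF THE ACTION.**  For every continuous link-summable link potential `V` with one-link oscillation loads `≤ η` (finite range or
not, inside the ball or not), every DLR `μ` of the Wilson action (bare coupling `β_W/2`), EVERY DLR `ν` of the action `+ V`, and every Lipschitz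
cylinder `F`: `|∫ F dμ − ∫ F dν| ≤ (√2/2)·min(η, 4)/(1 − 6β_W) · #Λ_F · K_F`. -/
theorem su2_wilson_stateStabilityS {βW : ℝ} (h0 : 0 ≤ βW) (h6 : βW < 1 / 6)
    {V : Potential (ZdEdge 4) (Matrix.specialUnitaryGroup (Fin 2) ℂ)}
    {BV : Finset (ZdEdge 4) → ℝ} (hV : IsLinkSummable V BV) (hVc : ∀ X, Continuous (V X))
    (hVdep : ∀ X, DependsOn (V X) (↑X : Set (ZdEdge 4)))
    {oscV : Finset (ZdEdge 4) → ZdEdge 4 → ℝ} (hoscV : ∀ X, Dobrushin.IsOscBound (V X) (oscV X))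
    (hoscVs : ∀ e, Summable fun X : Finset (ZdEdge 4) => (if e ∈ X then oscV X e else 0))
    {bV : ZdEdge 4 → ℝ} (hbV : ∀ e, ∑' X : Finset (ZdEdge 4), (if e ∈ X then oscV X e else 0) ≤ bV e)
    {η : ℝ} (hη : ∀ e, bV e ≤ η)
    {μ ν : Measure (LGConfig 4 (Matrix.specialUnitaryGroup (Fin 2) ℂ))}
    (hμ : μ ∈ ymGibbsMeasures (d := 4) (fundamentalRep (Fin 2)) (2 * (βW / 4)))
    (hν : ν ∈ perturbedGibbsMeasuresS (d := 4) (fundamentalRep (Fin 2)) (2 * (βW / 4)) (0 + V))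
    {F : LGConfig 4 (Matrix.specialUnitaryGroup (Fin 2) ℂ) → ℝ} {ΛF : Finset (ZdEdge 4)} {KF : ℝ≥0}
    (hF : IsLipschitzCylinder (fundamentalRep (Fin 2)) F ΛF KF) :
    |(∫ σ, F σ ∂μ) - ∫ σ, F σ ∂ν| ≤ Real.sqrt 2 / 2 * min η 4 / (1 - 6 * βW) * (ΛF.card * KF) := by
  have hmem : MemBallZdS (d := 4) (N := 2) 0 0 0 0 := memBallZdS_zero le_rfl le_rfl
  have hρ : 6 * |βW| * (exp 0 * exp 0) + exp (0 / 2) * Real.sqrt (2 / 3) * 0 < 1 := by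
    rw [abs_of_nonneg h0]; simp; linarith
  have hW0s : (0 : Potential (ZdEdge 4) (Matrix.specialUnitaryGroup (Fin 2) ℂ)).IsSupportedBy
      fun _ => (∅ : Finset (Finset (ZdEdge 4))) := fun Λ X _ h0 => absurd rfl h0
  have hμ' : μ ∈ perturbedGibbsMeasuresS (d := 4) (fundamentalRep (Fin 2)) (2 * (βW / 4)) 0 := by
    unfold perturbedGibbsMeasuresS
    rw [perturbedYMS_eq_perturbedYM (fundamentalRep (Fin 2)) (2 * (βW / 4)) (W := 0) hW0s]
    change μ ∈ perturbedGibbsMeasures (d := 4) (fundamentalRep (Fin 2)) (2 * (βW / 4)) 0 fun _ => ∅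
    rw [perturbedGibbsMeasures_zero]; exact hμ
  have key := su2_stateStabilityS_dim4 le_rfl hρ hmem hV hVc hVdep hoscV hoscVs hbV hη hμ' hν hF
  refine key.trans (le_of_eq ?_)
  rw [abs_of_nonneg h0]
  simp

end Summit.Ventures.YMGap.RobustBall

end
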